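import Summits.FinalStateConjecture.FinalStateConjecture.Theses.ZeroEnergyKerrOrBomb
import Summits.FinalStateConjecture.FinalStateConjecture.Theorems.ZeroEnergyKerrOrBombKerrOrBombOfCruxes
import Summits.FinalStateConjecture.FinalStateConjecture.Theorems.ErgoregionBomb.Negative.GrowthLaw
import Summits.FinalStateConjecture.FinalStateConjecture.Theorems.ErgoregionBomb.Negative.TrappingClauseVacuous
import Summits.FinalStateConjecture.FinalStateConjecture.Theorems.ZeroEnergyRigidity.Negative.KillingNonvanishingOfGH
import Summits.FinalStateConjecture.FinalStateConjecture.Theorems.ZeroEnergyRigidity.Negative.StationaryFieldRescaling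
import Summits.FinalStateConjecture.FinalStateConjecture.Theorems.ZeroEnergyRigidity.Negative.KerrParameterSign
import Literature.Geometry.Lorentzian.KillingModeStability
import Literature.Geometry.Lorentzian.StationaryBlackHoleUniquenessProofs
import Literature.Geometry.Lorentzian.KerrDataProofs
import Literature.Geometry.Lorentzian.KerrSchildCoord

/-!
# Disproof of `KerrOrBomb` — findings (cdisprove, crux `stmt-FinalStateConjecture-10689`,
# route `ZeroEnergyKerrOrBomb`; seat `refuter-cdisprove-stmt-FinalStateConjecture-10689-0`, 2026-08-16)

WORK FILE (standing adversary).  Prose lives in docstrings; every `theorem` without `sorry` is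
kernel-checked (`lean check` rc 0); `sorry` appears ONLY in §5 Near-misses.  Imports: the landed
negative lemmas of the two sibling cruxes (`ErgoregionBomb/Negative/{GrowthLaw,TrappingClauseVacuous}`,
`ZeroEnergyRigidity/Negative/{KillingNonvanishingOfGH,StationaryFieldRescaling,KerrParameterSign}`),
the landed glue `KerrOrBombOfCruxes_proof`, and `Literature/…/KillingModeStability`.

## VERDICT SO FAR: **NO KILL** — and none is expected from cheap means, for a structural reason:
`KerrOrBomb` is `CoreRigidityGH` (smooth stationary vacuum uniqueness with a global horizon Killing
field under global hyperbolicity) PLUS one extra hypothesis h6 (mode stability), so every refutation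
of the crux is in particular a refutation of `CoreRigidityGH`, on which three cdisprove cycles of the
sibling crux `ZeroEnergyRigidity` (stmt-10690, `Cruxes/ZeroEnergyRigidity/Disproof.lean` F1/F4/F13–F15)
found the junk surface closed and no witness in print (it is the open uniqueness problem, believed
true; with h3's global `K` it even reduces to the classical two-Killing-field theorems modulo
`I⁺`-regularity).  A witness against `KerrOrBomb` must moreover be MODE-STABLE as typed — 'dark hair'
(why-might-fail of the item): no 4-d vacuum example exists in print (§4).

## Findings (index)

* **(F0)** `kerrOrBomb_iff` — read-back, `Iff.rfl`: `∀ 𝓑, h1 → h2 → h3 → h4 → h5 →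
  𝓑.IsKillingModeStable → KerrConclusion 𝓑`; no junk operators (`dalembertian` = trace of Hessian,
  `mfderiv` of smooth functions, honest `|·| ≤ C`; `IsSubextremal M a := |a| < M` forces `M > 0`);
  **(F0′)** `kerrFacts` — the instance binders `[Kerr.Facts]`, `[HasLeviCivita]` are inhabited (tree
  theorems), so they neither trivialise the crux nor shelter it from a counterexample.
* **(F1)** `kerrOrBomb_iff_withoutH5` — h5 (`T ≠ 0` on doc) is DECORATION: implied by h4
  (landed `killing_ne_zero_of_mem_doc_of_isGloballyHyperbolic`, CC08 Cor. 3.8).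
* **(F2)** `kerrOrBomb_of_zeroEnergyRigidity_of_facts` — THE ROUTE NEVER CONSUMES h6: modulo three
  textbook causality facts `ErgoregionBomb` is vacuously true (`ergoregionBomb_of_causality_facts`,
  from the landed `trapping_clause_contradictory`), so the landed glue gives `ZeroEnergyRigidity →
  KerrOrBomb` outright, and `ZeroEnergyRigidity ≡ CoreRigidityGH` (sibling F2).  `kerrOrBomb_of_core`,
  `withoutModeStability_iff_core`: the crux minus h6 IS the core.  For provers: as the route stands
  the only proof on offer is full smooth uniqueness; USING h6 means building the bomb for a non-Kerr
  hole under the intended (mod-flow) trapping notion.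
* **(F3) Anatomy of h6** (all kernel-checked, for every presentation `𝓑`):
  (a) `not_isKillingModeStableNonneg`, `kerrOrBombNonnegModes_holds` — weakening `0 < ν` to `0 ≤ ν`
  makes h6 UNSATISFIABLE (constant pair `(1,0)`, `doc ≠ ∅`) and the crux vacuously true: strict
  growth is the only teeth; (b) `isKillingModePair_swap`, `isKillingModeStable_iff_nonneg_omega` —
  `(ψ,χ,ω) ↦ (χ,ψ,−ω)` is a symmetry, WLOG `0 ≤ ω`; (c) `isKillingModePair_rescale_iff`,
  `isKillingModeStable_rescale_iff`, `instance_rescale_iff` — h6 and the whole instance are invariant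
  under `T ↦ c • T` (`c > 0`, frequencies relabelled `c(ν + iω)`): `ν`, `ω` are not numbers of the
  hole without a normalisation of `T` the structure does not carry; (d) `modePair_eq_zero_of_bounded_on_doc`
  (UNCONDITIONAL: landed growth law + tree flow-invariance of the d.o.c.),
  `isKillingModeStableDocBounded_holds`, `kerrOrBombDocBounded_iff_core` — widening the boundedness
  region to the whole d.o.c. makes h6 a TAUTOLOGY and collapses the crux to `CoreRigidityGH`; so both
  parameters of the clause "`0 < ν`, bounded on `doc ∩ I⁻(embed '' e.far (e.R+1))`" are load-bearing
  and tuned against each other; (e) `modePair_eq_zero_of_closed_orbit`,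
  `isKillingModeStable_of_closed_orbits` — CLOSED stationary orbits through the d.o.c. make h6
  automatic (no wave equation, no bound): the `t*`-periodic quotient `Kerr/ℤ_L` is mode-stable as
  typed, satisfies h1 h2 h3 h5 and falsifies the conclusion (`π₁`), so h4's chronology clause is
  load-bearing for THIS crux too (§5 near-miss `kerrOrBomb_false_without_H4`); (f) docstring
  `h6_clauses_at_kerr_survey` (paper): at Schwarzschild/Kerr EACH analytic clause of h6 is necessary —
  drop `0 < ν`: constants; drop smoothness across `𝓗⁺`: WHITE-HOLE modes `e^{-iΩt}u_∞` (outgoing at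
  infinity, `A e^{-iΩu}`-irregular at `𝓗⁺`, yet BOUNDED on the past wedge, which meets `𝓗⁺` only at
  `v → −∞`); drop the past-wedge bound: ingoing growing modes regular at `𝓗⁺` — so the bound polices
  infinity and `horizon ⊆ U` alone polices `𝓗⁺` (a prover's bomb must be shown smooth across `𝓗⁺`).
* **(F4) Literature / dark hair** (§4 docstring `darkHair_survey`): what a countermodel must be.
* **(F5) Near-misses** (§5, sorried, docstrings carry witness + obstruction):
  `kerrOrBomb_false_without_H4` (Kerr/ℤ_L), `_without_H1` (Kerr–Newman: mode-stable by Civin 2014),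
  `_without_H3` (extremal Kerr: mode-stable by Teixeira da Costa 2020; needs a GH carrier),
  `_without_H2` (Minkowski).  NOT CLAIMED: `_without_H6` (= `CoreRigidityGH`, the open problem).
* **(F6)** `advice_and_pretriage_round1` (§6 docstring): for the TYPED decl every line of sibling crux
  10690 closes this crux with h6 unused (`kerrOrBomb_of_core`); spending h6 needs the intended
  (collar-local h3, mod-flow trapping) restate.  Pre-triage of `Ideas/phantom-horizons-have-surface-gravity.md`:
  pass-with-note (docks on the intended crux; First lemma vacuous on every in-tree (Kerr) model by
  `KerrNoZeroEnergyTrapping`; no trivial branch; transplant is a paper check).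
* **Targets**: none this cycle (`payload.targets = []`, no line picked yet).
* **LANDED** (negative lane, `--supports stmt-FinalStateConjecture-10689`, both ACCEPTED 2026-08-16):
  `Theorems/KerrOrBomb/Negative/ModeStabilityAnatomy.lean` — **p81059**, commit 1dacfcbc1aaf (F1, F3a,
  F3b, F3d, F3e: `kerrOrBomb_iff_withoutH5`, `isKillingModePair_const`,
  `exists_isKillingModePair_nonneg_ne_zero`, `isKillingModePair_swap`, `isKillingModeStable_iff_nonneg_omega`,
  `modePair_eq_zero_of_bounded_on_doc`, `isKillingModeStable_docBounded`, `modePair_eq_zero_of_closed_orbit`,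
  `isKillingModeStable_of_closed_orbits`) and `Theorems/KerrOrBomb/Negative/ModeStabilityRescaling.lean`
  — **p81110**, commit 4dc5e62e12b8 (F3c: `isKillingModePair_rescale_iff`, `isKillingModeStable_rescale_iff`,
  `kerrOrBomb_instance_rescale_iff`); namespace `…Theorems.KerrOrBomb.Negative`.  Ideators / planners /
  provers: import those modules rather than this workfile.
-/

noncomputable section

set_option linter.dupNamespace false
-- instance search through nested operator types (as in the tree files)
set_option maxSynthPendingDepth 3

namespace Summit.FinalStateConjecture.FinalStateConjecture.Cruxes.KerrOrBomb.Disproof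

open Set Literature.Geometry.Lorentzian
open scoped Manifold Topology
open Summit.FinalStateConjecture.FinalStateConjecture.Theses.ZeroEnergyKerrOrBomb
  (KerrOrBomb ZeroEnergyRigidity ErgoregionBomb KerrOrBombOfCruxes)

/-! ## §0  The telescope, named (read-back) -/

section Telescope

variable (𝓑 : StationaryAFBlackHole.{0}) [𝓑.metric.HasLeviCivita]

/-- h1: vacuum. -/
def H1 : Prop := 𝓑.metric.toPseudoRiemannianMetric.IsRicciFlat

/-- h2: connected (hence non-empty) future event horizon `𝓔⁺ = ∂I⁻(M_ext) ∩ I⁺(M_ext)`. -/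
def H2 : Prop := IsConnected 𝓑.horizon

/-- h3: non-degenerate horizon — `∃ K` Killing on the WHOLE carrier, `κ ≠ 0` (sibling finding F3). -/
def H3 : Prop := 𝓑.toSpacetime.IsNonDegenerateHorizon 𝓑.Mext

/-- h4: the CARRIER is globally hyperbolic. -/
def H4 : Prop := 𝓑.metric.IsGloballyHyperbolic 𝓑.timeOrientation

/-- h5: the stationary field has no zero in the d.o.c. -/
def H5 : Prop := ∀ p ∈ 𝓑.doc, 𝓑.killing p ≠ 0

/-- The conclusion: the d.o.c. is a sub-extremal Kerr exterior, fact-free chart form. -/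
def KerrConclusion [Kerr.Facts] : Prop :=
  ∃ (M a : ℝ), Kerr.IsSubextremal M a ∧ ∃ Ψ : Kerr.exterior M a → 𝓑.carrier,
    Function.Injective Ψ ∧ Set.range Ψ = 𝓑.doc ∧
      PseudoRiemannianMetric.IsIsometricImmersion
        (Kerr.smoothMetric M a (Kerr.rPlus M a)).toPseudoRiemannianMetric
        𝓑.metric.toPseudoRiemannianMetric Ψ

end Telescope

/-- **(F0) Read-back.** The crux is, character for character,
`∀ 𝓑, h1 → h2 → h3 → h4 → h5 → 𝓑.IsKillingModeStable → KerrConclusion 𝓑`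
(`IsKillingModeStable` from `Literature/…/KillingModeStability.lean`, `Iff.rfl`). -/
theorem kerrOrBomb_iff :
    KerrOrBomb ↔
      ∀ (𝓑 : StationaryAFBlackHole.{0}) [𝓑.metric.HasLeviCivita] [Kerr.Facts],
        H1 𝓑 → H2 𝓑 → H3 𝓑 → H4 𝓑 → H5 𝓑 → 𝓑.IsKillingModeStable → KerrConclusion 𝓑 :=
  Iff.rfl

/-- **(F0′) The instance binders are no shelter.**  `Kerr.Facts` holds outright (tree theorems),
and `𝓑.metric.HasLeviCivita` is inhabited for every smooth metric (`PseudoRiemannianMetric.hasLeviCivita`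
pattern of the tree), so a refutation `¬ KerrOrBomb` can instantiate both `[…]` binders — neither
makes the crux vacuously provable nor blocks a counterexample. -/
theorem kerrFacts : Kerr.Facts :=
  ⟨Kerr.isConnected_region_holds, Kerr.contMDiff_bilin_holds, Kerr.contMDiff_timeVector_holds⟩

/-! ## §1  Position of the crux in the route: h6 is never consumed -/

/-- The CORE statement (sibling file `Cruxes/ZeroEnergyRigidity/Disproof.lean`, `CoreRigidityGH`):
smooth stationary vacuum black-hole uniqueness with a global horizon Killing field, under global
hyperbolicity of the carrier — the crux with h5 AND h6 deleted. -/
def CoreRigidityGH : Prop :=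
  ∀ (𝓑 : StationaryAFBlackHole.{0}) [𝓑.metric.HasLeviCivita] [Kerr.Facts],
    H1 𝓑 → H2 𝓑 → H3 𝓑 → H4 𝓑 → KerrConclusion 𝓑

/-- The crux with h6 (mode stability) deleted: `FullRigidityGH` of the sibling file. -/
def KerrOrBombWithoutModeStability : Prop :=
  ∀ (𝓑 : StationaryAFBlackHole.{0}) [𝓑.metric.HasLeviCivita] [Kerr.Facts],
    H1 𝓑 → H2 𝓑 → H3 𝓑 → H4 𝓑 → H5 𝓑 → KerrConclusion 𝓑

/-- **h5 is redundant** (landed sibling lemma `killing_ne_zero_of_mem_doc_of_isGloballyHyperbolic`,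
Chruściel–Costa 2008 Cor. 3.8 + chronology ⊆ GH): `H4 → H5` for every presentation. -/
theorem h5_of_h4 (𝓑 : StationaryAFBlackHole.{0}) [𝓑.metric.HasLeviCivita] (h4 : H4 𝓑) : H5 𝓑 :=
  fun _ hp ↦ Theorems.ZeroEnergyRigidity.Negative.killing_ne_zero_of_mem_doc_of_isGloballyHyperbolic
    𝓑 h4 hp

/-- The crux with h5 deleted. -/
def KerrOrBombWithoutH5 : Prop :=
  ∀ (𝓑 : StationaryAFBlackHole.{0}) [𝓑.metric.HasLeviCivita] [Kerr.Facts],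
    H1 𝓑 → H2 𝓑 → H3 𝓑 → H4 𝓑 → 𝓑.IsKillingModeStable → KerrConclusion 𝓑

/-- **(F1) h5 is decoration**: the crux is equivalent to itself with h5 deleted (pure logic over
`h5_of_h4`). -/
theorem kerrOrBomb_iff_withoutH5 : KerrOrBomb ↔ KerrOrBombWithoutH5 :=
  ⟨fun h 𝓑 _ _ h1 h2 h3 h4 h6 ↦ h 𝓑 h1 h2 h3 h4 (h5_of_h4 𝓑 h4) h6,
    fun h 𝓑 _ _ h1 h2 h3 h4 _ h6 ↦ h 𝓑 h1 h2 h3 h4 h6⟩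

/-- `WithoutModeStability` is already the core (h5 implied by h4). -/
theorem withoutModeStability_iff_core : KerrOrBombWithoutModeStability ↔ CoreRigidityGH :=
  ⟨fun h 𝓑 _ _ h1 h2 h3 h4 ↦ h 𝓑 h1 h2 h3 h4 (h5_of_h4 𝓑 h4),
    fun h 𝓑 _ _ h1 h2 h3 h4 _ ↦ h 𝓑 h1 h2 h3 h4⟩

/-- Deleting a hypothesis only strengthens: `CoreRigidityGH → KerrOrBomb`. -/
theorem kerrOrBomb_of_core (h : CoreRigidityGH) : KerrOrBomb :=
  fun 𝓑 _ _ h1 h2 h3 h4 _ _ ↦ h 𝓑 h1 h2 h3 h4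

/-- **`ErgoregionBomb` is a theorem modulo three textbook causality facts** (landed sibling lemma
`trapping_clause_contradictory`, `Theorems/ErgoregionBomb/Negative/TrappingClauseVacuous.lean`):
its trapping clause imprisons a null geodesic ray in a compact subset of a globally hyperbolic
spacetime.  `hBS`, `hNI` are the tree's named facts (Bernal–Sánchez; non-imprisonment), `hEnd` is
O'Neill Ch. 5 Lemma 8 (affine rays are endless). -/
theorem ergoregionBomb_of_causality_facts
    (hBS : ∀ (𝓑 : StationaryAFBlackHole.{0}) (τ : TimeOrientation 𝓑.metric),
      𝓑.metric.bernalSanchez_isStronglyCausal_of_isGloballyHyperbolic τ)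
    (hNI : ∀ (𝓑 : StationaryAFBlackHole.{0}) (τ : TimeOrientation 𝓑.metric),
      LorentzianMetric.IsStronglyCausal.exists_forall_notMem_of_isCompact 𝓑.metric τ)
    (hEnd : ∀ (𝓑 : StationaryAFBlackHole.{0}) [𝓑.metric.HasLeviCivita] (γ : ℝ → 𝓑.carrier),
      IsGeodesicOn 𝓑.metric.leviCivita γ (Set.Ici 0) →
      (∀ s : ℝ, 0 ≤ s → velocity (𝓡 4) γ s ≠ 0) → IsFutureEndless γ (Set.Ici 0)) :
    ErgoregionBomb := by
  intro 𝓑 _ _ _ _ _ h4 _ γ K hg hz hK _ hin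
  exact (Theorems.ErgoregionBomb.Negative.trapping_clause_contradictory 𝓑 (hBS 𝓑) (hNI 𝓑)
    (hEnd 𝓑) h4 hg (fun s hs ↦ (hz s hs).1) hK hin).elim

/-- **(F2) The route's assembly never touches h6.**  Modulo the three causality facts,
`ZeroEnergyRigidity` ALONE implies `KerrOrBomb` (through the landed glue `KerrOrBombOfCruxes_proof`
and the vacuous `ErgoregionBomb`).  Since `ZeroEnergyRigidity` is itself `CoreRigidityGH` modulo the
same facts (sibling finding F2: its no-imprisoned-ray hypothesis is discharged by h4), the served
route proves the crux exactly when it proves full smooth uniqueness, and the mode-stability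
hypothesis is dead weight in the plan as typed.  A prover who wants to USE h6 must build the bomb
(the intended `ErgoregionBomb`, trapping modulo the flow). -/
theorem kerrOrBomb_of_zeroEnergyRigidity_of_facts
    (hBS : ∀ (𝓑 : StationaryAFBlackHole.{0}) (τ : TimeOrientation 𝓑.metric),
      𝓑.metric.bernalSanchez_isStronglyCausal_of_isGloballyHyperbolic τ)
    (hNI : ∀ (𝓑 : StationaryAFBlackHole.{0}) (τ : TimeOrientation 𝓑.metric),
      LorentzianMetric.IsStronglyCausal.exists_forall_notMem_of_isCompact 𝓑.metric τ)
    (hEnd : ∀ (𝓑 : StationaryAFBlackHole.{0}) [𝓑.metric.HasLeviCivita] (γ : ℝ → 𝓑.carrier),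
      IsGeodesicOn 𝓑.metric.leviCivita γ (Set.Ici 0) →
      (∀ s : ℝ, 0 ≤ s → velocity (𝓡 4) γ s ≠ 0) → IsFutureEndless γ (Set.Ici 0))
    (hZ : ZeroEnergyRigidity) : KerrOrBomb :=
  Theorems.KerrOrBombOfCruxes_proof hZ (ergoregionBomb_of_causality_facts hBS hNI hEnd)


/-! ## §2  Anatomy of h6 = `IsKillingModeStable` (load-bearing clauses, normal forms, covariance) -/

section Anatomy

variable (𝓑 : StationaryAFBlackHole.{0}) [𝓑.metric.HasLeviCivita]

/-! ### §2(a)  The only teeth on the hypothesis side of h6 is `0 < ν` -/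

/-- Constant pairs `(c, 0)` are Killing-mode pairs of frequency `0` (constants are smooth, solve
`□_g ψ = 0` by `PseudoRiemannianMetric.dalembertian_const`, have `dψ(T) = 0`, and are bounded). -/
theorem isKillingModePair_const (c : ℝ) : 𝓑.IsKillingModePair 0 0 (fun _ ↦ c) (fun _ ↦ 0) := by
  refine ⟨⟨univ, isOpen_univ, subset_univ _, contMDiffOn_const, contMDiffOn_const⟩,
    fun x _ ↦ ⟨?_, ?_⟩, fun x _ ↦ ?_, ⟨|c|, fun x _ ↦ by simp⟩⟩
  · exact PseudoRiemannianMetric.dalembertian_const _ c x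
  · exact PseudoRiemannianMetric.dalembertian_const _ 0 x
  · have h0 : mfderiv (𝓡 4) 𝓘(ℝ, ℝ) (fun _ : 𝓑.carrier ↦ (0 : ℝ)) x = 0 := mfderiv_const
    have hc : mfderiv (𝓡 4) 𝓘(ℝ, ℝ) (fun _ : 𝓑.carrier ↦ c) x = 0 := mfderiv_const
    refine ⟨?_, ?_⟩ <;>
      simp only [h0, hc, zero_apply, zero_mul, mul_zero, sub_self, add_zero] <;> rfl

/-- h6 with its growth condition `0 < ν` weakened to `0 ≤ ν` (everything else verbatim, bundled). -/
def IsKillingModeStableNonneg : Prop :=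
  ∀ (ν ω : ℝ) (ψ χ : 𝓑.carrier → ℝ), 0 ≤ ν → 𝓑.IsKillingModePair ν ω ψ χ →
    ∀ x ∈ 𝓑.doc, ψ x = 0 ∧ χ x = 0

/-- **The `0 ≤ ν` variant of h6 FAILS on every presentation** (witness: the constant pair `(1, 0)`
of frequency `0`, non-zero at a point of the d.o.c., which is non-empty by
`StationaryAFBlackHole.doc_nonempty` — `M_ext ⊆ ⟨⟨M_ext⟩⟩`, Chruściel–Costa 2008 §2.2).  So the
constraint `0 < ν` is exactly what keeps h6 satisfiable; stationary (`ν = ω = 0`) and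
time-periodic (`ν = 0`) bounded solutions are not "modes" of this crux. -/
theorem not_isKillingModeStableNonneg : ¬ IsKillingModeStableNonneg 𝓑 := by
  intro h
  obtain ⟨x₀, hx₀⟩ := 𝓑.doc_nonempty
  have := (h 0 0 (fun _ ↦ 1) (fun _ ↦ 0) le_rfl (isKillingModePair_const 𝓑 1) x₀ hx₀).1
  exact one_ne_zero this

/-- The crux with h6 replaced by its `0 ≤ ν` variant. -/
def KerrOrBombNonnegModes : Prop :=
  ∀ (𝓑 : StationaryAFBlackHole.{0}) [𝓑.metric.HasLeviCivita] [Kerr.Facts],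
    H1 𝓑 → H2 𝓑 → H3 𝓑 → H4 𝓑 → H5 𝓑 → IsKillingModeStableNonneg 𝓑 → KerrConclusion 𝓑

/-- **(F3a) … and that variant of the crux is VACUOUSLY TRUE** (no presentation satisfies the
strengthened h6).  Information for provers: any use of h6 must exploit STRICT exponential growth. -/
theorem kerrOrBombNonnegModes_holds : KerrOrBombNonnegModes :=
  fun 𝓑 _ _ _ _ _ _ _ h6 ↦ (not_isKillingModeStableNonneg 𝓑 h6).elim

/-! ### §2(b)  Normal form `0 ≤ ω`: the sign of the frequency is a relabelling -/

variable {𝓑} in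
/-- **Swap symmetry.** If `(ψ, χ)` is a Killing-mode pair of frequency `ν + iω` then `(χ, ψ)` is one
of frequency `ν − iω` (complex conjugation followed by multiplication by `i`: no negation of
functions is needed, only real arithmetic in the eigen-equations). -/
theorem isKillingModePair_swap {ν ω : ℝ} {ψ χ : 𝓑.carrier → ℝ} (h : 𝓑.IsKillingModePair ν ω ψ χ) :
    𝓑.IsKillingModePair ν (-ω) χ ψ := by
  obtain ⟨⟨U, hU, hsub, hψ, hχ⟩, hW, hE, ⟨C, hC⟩⟩ := h
  refine ⟨⟨U, hU, hsub, hχ, hψ⟩, fun x hx ↦ ⟨(hW x hx).2, (hW x hx).1⟩, fun x hx ↦ ⟨?_, ?_⟩,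
    ⟨C, fun x hx ↦ ⟨(hC x hx).2, (hC x hx).1⟩⟩⟩
  · have h2 : (mfderiv (𝓡 4) 𝓘(ℝ, ℝ) χ x (𝓑.killing x) : ℝ) = ω * ψ x + ν * χ x := (hE x hx).2
    show (mfderiv (𝓡 4) 𝓘(ℝ, ℝ) χ x (𝓑.killing x) : ℝ) = ν * χ x - (-ω) * ψ x
    rw [h2]; ring
  · have h1 : (mfderiv (𝓡 4) 𝓘(ℝ, ℝ) ψ x (𝓑.killing x) : ℝ) = ν * ψ x - ω * χ x := (hE x hx).1
    show (mfderiv (𝓡 4) 𝓘(ℝ, ℝ) ψ x (𝓑.killing x) : ℝ) = (-ω) * χ x + ν * ψ x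
    rw [h1]; ring

/-- **(F3b) Normal form of h6**: it suffices to kill the pairs with `0 ≤ ω` (or, symmetrically,
`ω ≤ 0`).  A prover's bomb may be normalised to co-rotating frequency sign; a disprover's mode
census need only cover a half-plane. -/
theorem isKillingModeStable_iff_nonneg_omega : 𝓑.IsKillingModeStable ↔
    ∀ (ν ω : ℝ) (ψ χ : 𝓑.carrier → ℝ), 0 < ν → 0 ≤ ω → 𝓑.IsKillingModePair ν ω ψ χ →
      ∀ x ∈ 𝓑.doc, ψ x = 0 ∧ χ x = 0 := by
  rw [StationaryAFBlackHole.isKillingModeStable_iff_forall_isKillingModePair]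
  refine ⟨fun h ν ω ψ χ hν _ hp ↦ h ν ω ψ χ hν hp, fun h ν ω ψ χ hν hp x hx ↦ ?_⟩
  rcases le_or_gt 0 ω with hω | hω
  · exact h ν ω ψ χ hν hω hp x hx
  · exact (h ν (-ω) χ ψ hν (by linarith) (isKillingModePair_swap hp) x hx).symm

/-! ### §2(c)  h6 never sees the normalisation of `T`: covariance under `T ↦ c • T` -/

open Theorems.ZeroEnergyRigidity.Negative.StationaryRescale in
/-- **Rescaling covariance of mode pairs.**  For the rescaled presentation `rescale 𝓑 hc`
(`T ↦ c • T`, `c > 0`; same spacetime, slice, end, `M_ext`, d.o.c. and horizon — landed sibling file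
`StationaryFieldRescaling.lean`) the Killing-mode pairs of frequency `c(ν + iω)` are exactly the
Killing-mode pairs of `𝓑` of frequency `ν + iω` (the eigen-equation is linear in `T`; the
smoothness, wave and boundedness clauses do not mention `T`). -/
theorem isKillingModePair_rescale_iff {c : ℝ} (hc : 0 < c) {ν ω : ℝ} {ψ χ : 𝓑.carrier → ℝ} :
    (rescale 𝓑 hc).IsKillingModePair (c * ν) (c * ω) ψ χ ↔ 𝓑.IsKillingModePair ν ω ψ χ := by
  have hdoc : (rescale 𝓑 hc).doc = 𝓑.doc := rescale_doc 𝓑 hc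
  have hhor : (rescale 𝓑 hc).horizon = 𝓑.horizon := rescale_horizon 𝓑 hc
  have key : ∀ (φ : 𝓑.carrier → ℝ) (x : 𝓑.carrier) (r : ℝ),
      (mfderiv (𝓡 4) 𝓘(ℝ, ℝ) φ x ((rescale 𝓑 hc).killing x) = c * r) ↔
        (mfderiv (𝓡 4) 𝓘(ℝ, ℝ) φ x (𝓑.killing x) = r) := by
    intro φ x r
    have hlin : mfderiv (𝓡 4) 𝓘(ℝ, ℝ) φ x ((rescale 𝓑 hc).killing x) =
        c • mfderiv (𝓡 4) 𝓘(ℝ, ℝ) φ x (𝓑.killing x) := by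
      rw [rescale_killing, Pi.smul_apply, ContinuousLinearMap.map_smul]
    rw [hlin]
    set dd : ℝ := mfderiv (𝓡 4) 𝓘(ℝ, ℝ) φ x (𝓑.killing x) with hdd
    show c * dd = c * r ↔ dd = r
    exact mul_right_inj' hc.ne'
  unfold StationaryAFBlackHole.IsKillingModePair
  rw [hdoc, hhor]
  refine and_congr Iff.rfl (and_congr Iff.rfl (and_congr ?_ Iff.rfl))
  refine forall₂_congr fun x _ ↦ ?_
  have e1 : c * ν * ψ x - c * ω * χ x = c * (ν * ψ x - ω * χ x) := by ring
  have e2 : c * ω * ψ x + c * ν * χ x = c * (ω * ψ x + ν * χ x) := by ring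
  exact and_congr (by rw [e1]; exact key ψ x _) (by rw [e2]; exact key χ x _)

open Theorems.ZeroEnergyRigidity.Negative.StationaryRescale in
/-- **(F3c) h6 is invariant under rescaling of the stationary field** (frequencies are relabelled
by the positive factor `c`, which preserves `0 < ν`).  Consequently the growth rate `ν` of a bomb
is NOT a number attached to the hole unless `T` is normalised (`g(T,T) → −1` at infinity is not a
field of the structure, sibling finding F10): scale-covariant statements only (`ν/κ`, `ω/Ω_H`, …). -/
theorem isKillingModeStable_rescale_iff {c : ℝ} (hc : 0 < c) :
    (rescale 𝓑 hc).IsKillingModeStable ↔ 𝓑.IsKillingModeStable := by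
  simp only [StationaryAFBlackHole.isKillingModeStable_iff_forall_isKillingModePair]
  have hdoc : (rescale 𝓑 hc).doc = 𝓑.doc := rescale_doc 𝓑 hc
  constructor
  · intro h ν ω ψ χ hν hp x hx
    have hp' : (rescale 𝓑 hc).IsKillingModePair (c * ν) (c * ω) ψ χ :=
      (isKillingModePair_rescale_iff 𝓑 hc).2 hp
    exact h (c * ν) (c * ω) ψ χ (mul_pos hc hν) hp' x (hdoc ▸ hx)
  · intro h ν ω ψ χ hν hp x hx
    have hp' : 𝓑.IsKillingModePair (c⁻¹ * ν) (c⁻¹ * ω) ψ χ := by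
      rw [← isKillingModePair_rescale_iff 𝓑 hc]
      simpa [← mul_assoc, mul_inv_cancel₀ hc.ne'] using hp
    exact h (c⁻¹ * ν) (c⁻¹ * ω) ψ χ (mul_pos (inv_pos.2 hc) hν) hp' x (hdoc ▸ hx)

open Theorems.ZeroEnergyRigidity.Negative.StationaryRescale in
/-- **The whole crux instance is rescaling-invariant**: h1–h4 and the conclusion see only the
metric, `M_ext`, `doc`, `horizon` (all unchanged), h5 and h6 are invariant.  No proof of the crux
can extract a normalisation of `T` from its hypotheses. -/
theorem instance_rescale_iff [Kerr.Facts] {c : ℝ} (hc : 0 < c) :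
    (H1 (rescale 𝓑 hc) → H2 (rescale 𝓑 hc) → H3 (rescale 𝓑 hc) → H4 (rescale 𝓑 hc) →
      H5 (rescale 𝓑 hc) → (rescale 𝓑 hc).IsKillingModeStable → KerrConclusion (rescale 𝓑 hc)) ↔
    (H1 𝓑 → H2 𝓑 → H3 𝓑 → H4 𝓑 → H5 𝓑 → 𝓑.IsKillingModeStable → KerrConclusion 𝓑) := by
  have h2 : H2 (rescale 𝓑 hc) ↔ H2 𝓑 := by unfold H2; rw [rescale_horizon]; exact Iff.rfl
  have h3 : H3 (rescale 𝓑 hc) ↔ H3 𝓑 := by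
    unfold H3; rw [rescale_Mext]; exact Iff.rfl
  have h5 : H5 (rescale 𝓑 hc) ↔ H5 𝓑 := rescale_killing_ne_zero_iff 𝓑 hc
  have h6 := isKillingModeStable_rescale_iff 𝓑 hc
  have hK : KerrConclusion (rescale 𝓑 hc) ↔ KerrConclusion 𝓑 := by
    unfold KerrConclusion; rw [rescale_doc]; exact Iff.rfl
  have h1 : H1 (rescale 𝓑 hc) ↔ H1 𝓑 := Iff.rfl
  have h4 : H4 (rescale 𝓑 hc) ↔ H4 𝓑 := Iff.rfl
  rw [h1, h2, h3, h4, h5, h6, hK]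

/-! ### §2(d)  The boundedness REGION is load-bearing: widened to the whole d.o.c., h6 is a tautology -/

variable {𝓑} in
/-- **Growth law ⇒ no `ν > 0` pair is bounded on the whole d.o.c.** — UNCONDITIONAL: the landed
sibling lemma `modePair_eq_zero_of_bounded_on_doc` (`(ψ² + χ²)∘φ_t = e^{2νt}(ψ² + χ²)` along the
complete stationary flow) with its forward-invariance hypothesis discharged by the tree theorem
`StationaryAFBlackHole.mem_doc_of_isMIntegralCurve` (the flow preserves `⟨⟨M_ext⟩⟩`,
Chruściel–Costa 2008 §2.2).  Neither the wave equation nor any hypothesis h1–h5 is used. -/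
theorem modePair_eq_zero_of_bounded_on_doc {ν ω : ℝ} {ψ χ : 𝓑.carrier → ℝ} (hν : 0 < ν)
    (hU : ∃ U : Set 𝓑.carrier, IsOpen U ∧ 𝓑.doc ∪ 𝓑.horizon ⊆ U ∧
      ContMDiffOn (𝓡 4) 𝓘(ℝ, ℝ) ((⊤ : ℕ∞) : WithTop ℕ∞) ψ U ∧
      ContMDiffOn (𝓡 4) 𝓘(ℝ, ℝ) ((⊤ : ℕ∞) : WithTop ℕ∞) χ U)
    (heig : ∀ x ∈ 𝓑.doc, mfderiv (𝓡 4) 𝓘(ℝ, ℝ) ψ x (𝓑.killing x) = ν * ψ x - ω * χ x ∧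
      mfderiv (𝓡 4) 𝓘(ℝ, ℝ) χ x (𝓑.killing x) = ω * ψ x + ν * χ x)
    (hb : ∃ C : ℝ, ∀ x ∈ 𝓑.doc, |ψ x| ≤ C ∧ |χ x| ≤ C) :
    ∀ x ∈ 𝓑.doc, ψ x = 0 ∧ χ x = 0 :=
  Theorems.ErgoregionBomb.Negative.modePair_eq_zero_of_bounded_on_doc 𝓑
    (fun _ hσ h0 t _ ↦ StationaryAFBlackHole.mem_doc_of_isMIntegralCurve hσ h0 t) hν hU heig hb

/-- h6 with the boundedness clause widened from `doc ∩ I⁻(far slice region)` to the whole `doc`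
(a WEAKER hypothesis on the hole: fewer test pairs pass the boundedness filter). -/
def IsKillingModeStableDocBounded : Prop :=
  ∀ (ν ω : ℝ) (ψ χ : 𝓑.carrier → ℝ), 0 < ν →
    (∃ U : Set 𝓑.carrier, IsOpen U ∧ 𝓑.doc ∪ 𝓑.horizon ⊆ U ∧
      ContMDiffOn (𝓡 4) 𝓘(ℝ, ℝ) ((⊤ : ℕ∞) : WithTop ℕ∞) ψ U ∧
        ContMDiffOn (𝓡 4) 𝓘(ℝ, ℝ) ((⊤ : ℕ∞) : WithTop ℕ∞) χ U) →
    (∀ x ∈ 𝓑.doc, 𝓑.metric.dalembertian ψ x = 0 ∧ 𝓑.metric.dalembertian χ x = 0) →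
    (∀ x ∈ 𝓑.doc, mfderiv (𝓡 4) 𝓘(ℝ, ℝ) ψ x (𝓑.killing x) = ν * ψ x - ω * χ x ∧
      mfderiv (𝓡 4) 𝓘(ℝ, ℝ) χ x (𝓑.killing x) = ω * ψ x + ν * χ x) →
    (∃ C : ℝ, ∀ x ∈ 𝓑.doc, |ψ x| ≤ C ∧ |χ x| ≤ C) →
    ∀ x ∈ 𝓑.doc, ψ x = 0 ∧ χ x = 0

/-- **The widened h6 holds on EVERY presentation** (growth law; wave equation unused). -/
theorem isKillingModeStableDocBounded_holds : IsKillingModeStableDocBounded 𝓑 :=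
  fun _ _ _ _ hν hU _ heig hb ↦ modePair_eq_zero_of_bounded_on_doc hν hU heig hb

/-- The typed h6 implies the widened one (and the widened one is free), for the record. -/
theorem isKillingModeStableDocBounded_of_isKillingModeStable (h : 𝓑.IsKillingModeStable) :
    IsKillingModeStableDocBounded 𝓑 :=
  fun _ _ _ _ hν hU hW heig hb ↦ h _ _ _ _ hν hU hW heig
    (hb.imp fun _ hC x hx ↦ hC x hx.1)

/-- The crux with h6 widened to d.o.c.-boundedness. -/
def KerrOrBombDocBounded : Prop :=
  ∀ (𝓑 : StationaryAFBlackHole.{0}) [𝓑.metric.HasLeviCivita] [Kerr.Facts],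
    H1 𝓑 → H2 𝓑 → H3 𝓑 → H4 𝓑 → H5 𝓑 → IsKillingModeStableDocBounded 𝓑 → KerrConclusion 𝓑

/-- **(F3d) Widening the boundedness region collapses the crux to full rigidity**:
`KerrOrBombDocBounded ↔ CoreRigidityGH`, unconditionally.  Together with (F3a) this brackets h6:
`0 ≤ ν` makes it unsatisfiable, `bounded on doc` makes it a tautology; the typed clause
"bounded on `doc ∩ I⁻(embed '' e.far (e.R+1))`, `0 < ν`" sits strictly between, and BOTH of its
parameters are load-bearing. -/
theorem kerrOrBombDocBounded_iff_core : KerrOrBombDocBounded ↔ CoreRigidityGH :=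
  ⟨fun h 𝓑 _ _ h1 h2 h3 h4 ↦ h 𝓑 h1 h2 h3 h4 (h5_of_h4 𝓑 h4) (isKillingModeStableDocBounded_holds 𝓑),
    fun h 𝓑 _ _ h1 h2 h3 h4 _ _ ↦ h 𝓑 h1 h2 h3 h4⟩

/-! ### §2(e)  Closed stationary orbits make h6 automatic (why h4's chronology clause is load-bearing) -/

variable {𝓑} in
omit [𝓑.metric.HasLeviCivita] in
/-- **A `ν > 0` pair vanishes on every CLOSED stationary orbit** along which the eigen-equations
hold: `(ψ² + χ²)(σ L) = e^{2νL}(ψ² + χ²)(σ 0)` (landed growth law `modePair_sq_eq_exp`) and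
`σ L = σ 0`, `e^{2νL} > 1`.  No boundedness, no wave equation. -/
theorem modePair_eq_zero_of_closed_orbit {σ : ℝ → 𝓑.carrier} (hσ : IsMIntegralCurve σ 𝓑.killing)
    {L : ℝ} (hL : 0 < L) (hper : σ L = σ 0) {ν ω : ℝ} {ψ χ : 𝓑.carrier → ℝ} (hν : 0 < ν)
    (hd : ∀ t, MDifferentiableAt (𝓡 4) 𝓘(ℝ, ℝ) ψ (σ t) ∧ MDifferentiableAt (𝓡 4) 𝓘(ℝ, ℝ) χ (σ t))
    (heig : ∀ t, mfderiv (𝓡 4) 𝓘(ℝ, ℝ) ψ (σ t) (𝓑.killing (σ t)) = ν * ψ (σ t) - ω * χ (σ t) ∧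
      mfderiv (𝓡 4) 𝓘(ℝ, ℝ) χ (σ t) (𝓑.killing (σ t)) = ω * ψ (σ t) + ν * χ (σ t)) :
    ψ (σ 0) = 0 ∧ χ (σ 0) = 0 := by
  have hgrow := Theorems.ErgoregionBomb.Negative.modePair_sq_eq_exp 𝓑 hσ Set.ordConnected_univ
    (fun t _ ↦ hd t) (fun t _ ↦ heig t) (Set.mem_univ 0) (Set.mem_univ L)
  rw [hper, sub_zero] at hgrow
  set E₀ := ψ (σ 0) ^ 2 + χ (σ 0) ^ 2 with hE₀
  have hexp : 1 < Real.exp (2 * ν * L) := Real.one_lt_exp_iff.2 (by positivity)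
  have hE₀z : E₀ = 0 := by nlinarith [sq_nonneg (ψ (σ 0)), sq_nonneg (χ (σ 0))]
  have hψ0 : ψ (σ 0) ^ 2 = 0 := by nlinarith [sq_nonneg (ψ (σ 0)), sq_nonneg (χ (σ 0))]
  have hχ0 : χ (σ 0) ^ 2 = 0 := by nlinarith [sq_nonneg (ψ (σ 0)), sq_nonneg (χ (σ 0))]
  exact ⟨pow_eq_zero_iff (n := 2) (by norm_num) |>.mp hψ0,
    pow_eq_zero_iff (n := 2) (by norm_num) |>.mp hχ0⟩

/-- **(F3e) Presentations whose stationary orbits through the d.o.c. are closed satisfy h6 for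
free.**  This is exactly why the `t*`-periodic quotient `Kerr/ℤ_L` of a Kerr black-hole chart
(sibling junk item 8: h1 vacuum, h2 horizon `S¹ × S²` connected, h3 `K = T + Ω_H Φ` descends, h5
`T ≠ 0`; conclusion FALSE: `π₁(doc) = ℤ` while the Kerr exterior is simply connected and a
bijective immersion of 4-manifolds is a diffeomorphism) is ALSO mode-stable as typed — it would
refute the crux but for h4 (closed timelike curves in `M_ext`).  So the chronology clause of h4 is
load-bearing for `KerrOrBomb`, and mode stability as typed does not detect time-periodic
identifications at all. -/
theorem isKillingModeStable_of_closed_orbits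
    (hcl : ∀ x ∈ 𝓑.doc, ∃ (σ : ℝ → 𝓑.carrier) (L : ℝ),
      IsMIntegralCurve σ 𝓑.killing ∧ σ 0 = x ∧ 0 < L ∧ σ L = σ 0) :
    𝓑.IsKillingModeStable := by
  intro ν ω ψ χ hν hU _ heig _ x hx
  obtain ⟨U, hUo, hsub, hψ, hχ⟩ := hU
  obtain ⟨σ, L, hσ, hσ0, hL, hper⟩ := hcl x hx
  have hdoc : ∀ t, σ t ∈ 𝓑.doc := fun t ↦
    StationaryAFBlackHole.mem_doc_of_isMIntegralCurve hσ (hσ0 ▸ hx) t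
  have hd : ∀ t, MDifferentiableAt (𝓡 4) 𝓘(ℝ, ℝ) ψ (σ t) ∧
      MDifferentiableAt (𝓡 4) 𝓘(ℝ, ℝ) χ (σ t) := fun t ↦ by
    have hmem : U ∈ 𝓝 (σ t) := hUo.mem_nhds (hsub (Or.inl (hdoc t)))
    exact ⟨(hψ.contMDiffAt hmem).mdifferentiableAt (by simp),
      (hχ.contMDiffAt hmem).mdifferentiableAt (by simp)⟩
  have h := modePair_eq_zero_of_closed_orbit hσ hL hper hν hd (fun t ↦ heig (σ t) (hdoc t))
  rwa [hσ0] at h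

end Anatomy

/-! ### §2(f)  The three analytic clauses of h6 at the intended model (on paper; for provers of bombs) -/

/-- **(F3f) Each analytic clause of h6 is necessary already at Schwarzschild/Kerr** (paper
computation with separated modes `Φ = e^{-iΩt} u(r*) Y_{ℓm}(θ,φ)/r`, `Ω = −ω' + iν` say, `ν = Im Ω > 0`,
radial ODE `u'' + (Ω² − V_ℓ)u = 0`, branches `e^{±iΩr*}` at both ends, `|e^{iΩr*}| = e^{−νr*}`):

1. `0 < ν` — dropped (`0 ≤ ν`): constants, and for real `Ω ≠ 0` the scattering states (regular at
   `𝓗⁺`, `O(1/r)` at infinity, bounded everywhere) violate h6: kernel-checked for constants (F3a).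
2. SMOOTH ACROSS `𝓗⁺` (`doc ∪ horizon ⊆ U`) — dropped (smooth on `doc` only): for EVERY `Ω` with
   `Im Ω > 0` let `u_∞` be the radial solution that is `e^{iΩr*}` (outgoing, `L²`) at `r* → +∞`; at
   the horizon `u_∞ ~ A e^{iΩr*} + B e^{-iΩr*}` with `A ≠ 0` BY WHITING (else a finite-energy growing
   mode).  The spacetime function `Φ_Ω = e^{-iΩt} u_∞ Y/r` is smooth on the exterior, solves `□Φ = 0`,
   has `TΦ = −iΩΦ` (growth `e^{νt}`), and IS BOUNDED ON THE PAST WEDGE `doc ∩ I⁻(far slice region)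
   ⊆ {u = t − r* ≤ u₀}`: near infinity `|Φ| ≲ e^{νu}/r ≤ e^{νu₀}`, near the horizon
   `|Φ| ≲ |A| e^{νu} + |B| e^{νv} ≤ (|A| + |B|) e^{νu₀}` (on the wedge `v = u + 2r* ≤ u₀ + 2r*`), in
   between `t ≤ const`.  But `A e^{-iΩu} = A e^{-iΩv}(r − r₊)^{iΩ/κ}·(smooth)` has modulus
   `∝ (r − r₊)^{−ν/κ} → ∞` along `v = const`: NOT smooth (not even bounded) at `𝓗⁺`.  So WITHOUT the
   horizon-regularity clause h6 FAILS at every Kerr presentation (white-hole modes), and the crux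
   with that h6 is vacuously true at its intended model.  MORAL (corrects the naive reading, which
   this seat also first made): the past-wedge bound does NOT police the future horizon — the wedge
   meets `𝓗⁺` only at `v → −∞` — it polices spatial/past-null infinity; regularity at `𝓗⁺` is
   carried entirely by `horizon ⊆ U`.  A prover's bomb must therefore be shown SMOOTH ACROSS `𝓗⁺`
   (ingoing/regular branch), which is where the horizon flux `ω(ω − mΩ_H)` enters.
3. BOUNDED ON THE PAST WEDGE — dropped: let `u_H` be the radial solution regular at `𝓗⁺`
   (`e^{-iΩr*}` there, i.e. `Φ ∝ e^{-iΩv}` smooth across the horizon in ingoing coordinates); at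
   infinity `u_H ~ C e^{iΩr*} + D e^{-iΩr*}` with `D ≠ 0` BY WHITING; `Φ = e^{-iΩt}u_H Y/r` is smooth
   on a neighbourhood of `doc ∪ 𝓗⁺`, solves the wave and eigen equations, and is unbounded only
   through `D e^{-iΩv}/r`, `|·| = e^{νv}/r`, as `r → ∞` below the slice (`v = t* + r → ∞` on the
   wedge).  So WITHOUT the boundedness clause h6 FAILS at Kerr as well (ingoing growing modes).
Hence at the intended model the typed h6 is the conjunction of exactly the three conditions that
single out "no finite-energy exponentially growing mode regular at `𝓗⁺`" = Whiting's theorem, each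
indispensable; none of 1–3 is kernel-checkable here without a coordinate d'Alembertian on a Kerr
presentation (the tree's `PhotonSphereChannels*` Regge–Wheeler machinery is the nearest asset).
References: Whiting 1989; Shlapentokh-Rothman CMP 329 (2014) §3 ("all solutions are either
exponentially growing or exponentially decaying at infinity"), AHP 16 (2015) Def. 1.1. -/
theorem h6_clauses_at_kerr_survey : True := trivial



/-! ## §3  The conclusion: tightness (landed sibling file `KerrParameterSign.lean`, p73548) -/

section Conclusion

open Theorems.ZeroEnergyRigidity.Negative

variable (𝓑 : StationaryAFBlackHole.{0}) [Kerr.Facts]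

/-- The conclusion is `∃ (M, a) sub-extremal, KerrExteriorPresentation 𝓑 M a` (`Iff.rfl`). -/
theorem kerrConclusion_iff_exists_presentation :
    KerrConclusion 𝓑 ↔ ∃ M a : ℝ, Kerr.IsSubextremal M a ∧ KerrExteriorPresentation 𝓑 M a :=
  Iff.rfl

/-- **Normal form of the conclusion**: the sign of `a` is redundant (`Kerr(M,−a) ≅ Kerr(M,a)` by the
reflection `y ↦ −y`, landed `isIsometricImmersion_reflExt`), so WLOG `0 ≤ a`; an
`∃!`-strengthening of the conclusion is false for rotating presentations (sibling (b′)). -/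
theorem kerrConclusion_iff_nonneg :
    KerrConclusion 𝓑 ↔ ∃ M a : ℝ, Kerr.IsSubextremal M a ∧ 0 ≤ a ∧ KerrExteriorPresentation 𝓑 M a :=
  exists_kerrExteriorPresentation_iff_nonneg 𝓑

/-- `IsSubextremal M a := |a| < M` forces `0 < M`: no `M ≤ 0` junk (flat `M = 0`, negative-mass
naked singularities) can inhabit the conclusion; in particular a FLAT d.o.c. (Minkowski-type
presentations, §5 `kerrOrBomb_false_without_H2`) never satisfies it for curvature reasons. -/
theorem pos_mass_of_kerrConclusion (h : KerrConclusion 𝓑) : ∃ M a : ℝ, 0 < M ∧ |a| < M ∧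
    KerrExteriorPresentation 𝓑 M a := by
  obtain ⟨M, a, hMa, hP⟩ := h
  exact ⟨M, a, lt_of_le_of_lt (abs_nonneg a) hMa, hMa, hP⟩

end Conclusion

/-! ## §4  What a kill would have to be ('dark hair'); inhabitant / non-vacuity of h6 -/

/-- **(F4) Survey — what a countermodel to `KerrOrBomb` must be, and why none is available**
(no Lean content; `True`).

1. NON-VACUITY.  The hypothesis CLASS of h6 is never empty (`isKillingModePair_zero`,
   `isKillingModePair_const`: the zero pair and the constants), and h6 itself is satisfiable with
   a TRUE conclusion by the intended model: the sub-extremal Kerr presentation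
   `Kerr.stationaryAFBlackHoleOn M a r₀`, `|a| < M`, `r₋ ≤ max r₀ 0 < r₊` (sibling F4; conclusion
   holds with `Ψ =` the chart inclusion once `doc = {r > r₊}` is identified) is mode-stable as typed
   modulo the support item `KerrModeStability` (Whiting 1989; Shlapentokh-Rothman AHP 16 (2015)
   Thm 1.5; Teixeira da Costa CMP 2020 = arXiv:1910.02854 Thm 1.1) plus the reduction of unseparated
   bounded-on-the-past-wedge eigenfunctions to outgoing separated modes (standard but not vendored).
   So neither "h6 unsatisfiable ⇒ crux vacuously true" nor "h6 trivially true ⇒ crux = Core" holds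
   for the typed clause — (F3a)/(F3d) show its two parameters sit exactly at the non-degenerate
   values.
2. WHAT A WITNESS IS.  `¬ KerrOrBomb` needs a smooth `𝓑` with: Ricci-flat metric (h1), connected
   non-empty future event horizon (h2) carrying a GLOBAL Killing field `K` with `κ ≠ 0` (h3 — the
   conclusion of Hawking rigidity as a hypothesis, sibling F3), globally hyperbolic carrier (h4),
   mode-stable wave equation (h6), and d.o.c. NOT a sub-extremal Kerr exterior.  By (F2)/sibling F4
   every such `𝓑` refutes `CoreRigidityGH` already; the junk surface of the formalisation
   (Minkowski / exterior-only / white-hole / super-extremal: `𝓔⁺ = ∅`; `t*`-periodic and antipodal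
   quotients, charts through the Cauchy horizon or the disc: not GH or not AF; extremal: `κ = 0` and
   no GH horizon-penetrating chart in the tree; Kerr–Newman: not Ricci-flat; `T`-invariant GH
   sub-carriers of a Kerr chart: conclusion still TRUE since `doc_U = {r > r₊}`) is closed, and
   h6 adds a further filter which the only junk presentation passing h1 h2 h3 h5 — `Kerr/ℤ_L` —
   passes for free (F3e) but which h4 kills anyway.
3. IN PRINT.  No smooth 4-d asymptotically flat stationary VACUUM black hole other than Kerr is
   known; uniqueness is proved under analyticity (Chruściel–Costa 2008 Thm 1.3, tree schema
   `stationary_black_hole_uniqueness`), under closeness to Kerr (Alexakis–Ionescu–Klainerman,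
   arXiv:0904.0982) and for small `a` on the horizon (arXiv:1304.0487); Ionescu–Klainerman's local
   non-Kerr stationary vacuum extensions (arXiv:1108.3575 = barrier
   `Literature.Barriers.FinalStateConjecture.IonescuKlainermanNonExtension`) live behind/at one
   horizon point and have no known AF completion.  With h3's global `K ∉ ℝT` the hole is stationary
   AND carries a second Killing field, where the Ernst-reduction uniqueness theorems
   (Carter–Robinson–Mazur–Bunting; Chruściel–Costa–Heusler LRR 2012, tree schema
   `ChruscielCostaHeusler2012_axisymmetricUniqueness`) apply modulo `I⁺`-regularity and axis
   regularity; with `K ∈ ℝT` (non-rotating) Sudarsky–Wald staticity + Israel–Bunting–Masood give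
   Schwarzschild.  So a witness is a counterexample to Hawking-rigid smooth uniqueness WITHOUT
   `I⁺`-regularity — not in print, believed not to exist.
4. 'DARK HAIR' (the item's why-might-fail: a non-Kerr vacuum hole whose zero-energy trapping leaks
   into the horizon faster than superradiance feeds it, hence mode-stable) presupposes item 3's
   object; the mode-stable NON-vacuum / non-sub-extremal neighbours that DO exist — Kerr–Newman
   (Civin arXiv:1405.3620 §3 Thm "Mode Stability": no non-trivial mode solutions with `Im ω > 0` on
   sub-extremal KN, `a² + Q² < M²`) and extremal Kerr (Teixeira da Costa arXiv:1910.02854 Thm 1.2) —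
   are exactly the §5 witnesses that h1 and h3 are load-bearing.  Moschidis's deformed-Kerr bombs
   (arXiv:1608.02041 Thm 2) are non-vacuum and mode-UNstable (they inhabit ¬h6, not ¬KerrOrBomb).
5. LITERATURE SERVICES this session: `lit search` rc 75 (searchd) ×3, OpenAlex/S2/arXiv HTTP 429,
   galaxy substring 0 rows — `search-degraded`; items 3–4 rest on held texts (arXiv:1405.3620 p. 6,
   arXiv:1910.02854 p. 4, materialised) and on the sibling files' verified reads. -/
theorem darkHair_survey : True := trivial

/-! ## §5  Near-misses: `_false_without_<H>` with witness and obstruction (sorried; NOT landed) -/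

/-- The crux with h4 (global hyperbolicity) deleted. -/
def KerrOrBombWithoutH4 : Prop :=
  ∀ (𝓑 : StationaryAFBlackHole.{0}) [𝓑.metric.HasLeviCivita] [Kerr.Facts],
    H1 𝓑 → H2 𝓑 → H3 𝓑 → H5 𝓑 → 𝓑.IsKillingModeStable → KerrConclusion 𝓑

/-- The crux with h1 (vacuum) deleted. -/
def KerrOrBombWithoutH1 : Prop :=
  ∀ (𝓑 : StationaryAFBlackHole.{0}) [𝓑.metric.HasLeviCivita] [Kerr.Facts],
    H2 𝓑 → H3 𝓑 → H4 𝓑 → H5 𝓑 → 𝓑.IsKillingModeStable → KerrConclusion 𝓑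

/-- The crux with h2 (connected, hence non-empty, horizon) deleted. -/
def KerrOrBombWithoutH2 : Prop :=
  ∀ (𝓑 : StationaryAFBlackHole.{0}) [𝓑.metric.HasLeviCivita] [Kerr.Facts],
    H1 𝓑 → H3 𝓑 → H4 𝓑 → H5 𝓑 → 𝓑.IsKillingModeStable → KerrConclusion 𝓑

/-- **Near-miss (h4 is load-bearing).**  WITNESS: the `t*`-periodic quotient `Kerr/ℤ_L` of a
sub-extremal Kerr–Schild black-hole chart `{r > r₀}`, `r₋ < r₀ < r₊` (period `L > 0` in `t*`;
`T = ∂_{t*}`, `Φ`, the metric and the slice `{t* = 0}` descend).  h1 ✓ (vacuum), h2 ✓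
(`𝓔⁺ = {r = r₊}/ℤ ≅ S¹ × S²` connected), h3 ✓ (`K = T + Ω_H Φ` descends, `κ > 0`), h5 ✓, and
**h6 ✓ by `isKillingModeStable_of_closed_orbits`** (every `T`-orbit is closed of period `L`);
conclusion ✗ (`π₁(doc) = ℤ`, the Kerr exterior `ℝ × {‖x‖ > r₊}` is simply connected, and a
bijective smooth immersion of 4-manifolds is a diffeomorphism).  OBSTRUCTION (why `sorry`): the
quotient manifold as a `StationaryAFBlackHole` (charts, AF slice data, `induced_h/k`) and the
Ricci-flatness of the Kerr–Schild metric are not in the tree (weeks of formalisation, no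
mathematical doubt).  h4 fails there only through CHRONOLOGY (closed timelike `T`-orbits in
`M_ext`), the same clause that makes h5 redundant (F1). -/
theorem kerrOrBomb_false_without_H4 : ¬ KerrOrBombWithoutH4 := by
  sorry

/-- **Near-miss (h1 is load-bearing).**  WITNESS: sub-extremal Kerr–Newman `a² + Q² < M²`,
`Q ≠ 0`, in ingoing Kerr–Schild form on `{r > r₀}`, `r₋ < r₀ < r₊`.  h2 ✓, h3 ✓ (`K = T + Ω_H Φ`,
`κ = (r₊ − r₋)/(2(r₊² + a²)) > 0`), h4 ✓ (`{r = r₀}` spacelike), h5 ✓, **h6 ✓ by Civin 2014**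
(arXiv:1405.3620 §3, Thm "Mode Stability": "There exist no non-trivial mode solutions
corresponding to `Im ω > 0`" for the scalar wave equation on sub-extremal Kerr–Newman — the exact
analogue of Whiting; plus the same unseparated-to-separated reduction as for Kerr); conclusion ✗
IMMEDIATELY: an isometric immersion of a Ricci-flat Kerr exterior ONTO the open d.o.c. would make
the Kerr–Newman d.o.c. Ricci-flat, but `Ric(g_{KN}) = 8π T_{EM} ≠ 0` for `Q ≠ 0`.  OBSTRUCTION:
Kerr–Newman is not in the tree; h6 for it is a Whiting-level theorem (held text, not vendored). -/
theorem kerrOrBomb_false_without_H1 : ¬ KerrOrBombWithoutH1 := by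
  sorry

/-- **h2 is what gives h3 its teeth**: on a presentation with EMPTY future event horizon, h3 holds
trivially with `K = T`, `κ = 1` (the warning in `Stationary.lean`'s docstring of
`IsNonDegenerateHorizon`, kernel-checked).  Used by the `_without_H2` near-miss below. -/
theorem h3_of_horizon_eq_empty (𝓑 : StationaryAFBlackHole.{0}) [𝓑.metric.HasLeviCivita]
    (h : 𝓑.horizon = ∅) : H3 𝓑 := by
  have hno : ∀ p, p ∉ 𝓑.horizon := fun p hp ↦ by simp [h] at hp
  refine ⟨𝓑.killing, 𝓑.isStationaryKilling.isKillingField, fun p hp ↦ (hno p hp).elim,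
    fun γ _ h0 ↦ (hno _ h0).elim, ⟨1, one_ne_zero, fun p hp ↦ (hno p hp).elim⟩⟩

/-- **Near-miss (h2 is load-bearing).**  WITNESS: Minkowski space `ℝ⁴`, `T = ∂ₜ`, slice `{t = 0}`
(in the tree as the `M = 0` member of the Kerr–Schild family on the whole of `E4`, modulo
identifications).  h1 ✓ (flat), h3 ✓ VACUOUSLY (`𝓔⁺ = ∅`: take `K = T`, `κ = 1`), h4 ✓, h5 ✓,
**h6 ✓**: `doc = ℝ⁴`, and a smooth `Φ = ψ + iχ` with `□Φ = 0`, `∂ₜΦ = (ν + iω)Φ`, `ν > 0`, is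
`e^{(ν+iω)t} Φ₀(x)` with `ΔΦ₀ = (ν + iω)² Φ₀`; boundedness on `doc ∩ I⁻({t = 0, ‖x‖ > R + 1}) ⊇
{t < −(R+1)}` makes `Φ₀` bounded, hence a tempered distribution with `(|ξ|² + (ν+iω)²) Φ̂₀ = 0`,
and `|ξ|² + (ν + iω)² ≠ 0` for real `ξ` when `ν > 0` (imaginary part `2νω = 0` forces `ω = 0`, then
`|ξ|² + ν² > 0`), so `Φ₀ = 0` (Liouville for the Helmholtz operator).  Conclusion ✗: the d.o.c. is
FLAT while every sub-extremal Kerr exterior has `M > 0` (`pos_mass_of_kerrConclusion`) and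
non-vanishing curvature, and an isometric immersion onto an open set preserves curvature.
OBSTRUCTION: global hyperbolicity of the in-tree Minkowski carrier and the distributional Liouville
step are not vendored.  (Any HORIZONLESS mode-stable stationary vacuum spacetime would do; by the
positive-mass/Lichnerowicz-type rigidity a geodesically complete one is Minkowski anyway.) -/
theorem kerrOrBomb_false_without_H2 : ¬ KerrOrBombWithoutH2 := by
  sorry

/-- **NOT CLAIMED** (recorded so nobody re-hunts them cheaply):
* `_without_H3`: the natural witness is EXTREMAL Kerr `|a| = M` (h1 h2 h5 ✓; h6 ✓ by Teixeira da
  Costa arXiv:1910.02854 Thm 1.2, mode stability of the Teukolsky equation of every spin on extremal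
  Kerr in the closed upper half-plane; conclusion ✗ since `|a| < M` fails for every isometric Kerr
  model of the d.o.c. — mass and `|a|` are isometry invariants of the exterior), BUT no `T`-invariant
  globally hyperbolic carrier containing `doc ∪ 𝓔⁺` of extremal Kerr is in the tree or evident
  (`{r > r₀}`, `0 < r₀ < M`, has the TIMELIKE boundary `{r = r₀}` since `Δ = (r − M)² > 0`; sibling
  junk item 6); h3 moreover supplies the global second Killing field, so without it the crux is the
  full AIK-type problem for mode-stable holes.  Open either way; no cheap witness.
* `_without_H6` = `KerrOrBombWithoutModeStability ↔ CoreRigidityGH` (`withoutModeStability_iff_core`):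
  the smooth uniqueness problem itself — a witness would be a new solution of the stationary vacuum
  Einstein equations (§4 item 3).  That "any proof must use h6" can therefore NOT be certified by a
  counterexample; it is only the (well-founded) belief that `CoreRigidityGH` is presently unprovable.
* `_without_H5`: impossible — h5 is implied by h4 (F1). -/
theorem notClaimed_pointer : True := trivial


/-! ## §6  For ideators / the lead: what the typed decl leaves to prove; pre-triage of round-1 ideas -/

/-- **(F6) Lines for the TYPED decl are lines for `CoreRigidityGH` (and conversely, modulo using h6).**
By `kerrOrBomb_of_core` every proof line of the sibling crux `ZeroEnergyRigidity` (stmt-10690, whose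
typed form IS the core modulo non-imprisonment; picked line `Lines/global-horizon-killing-field.lean`,
stubs S1–S3: I⁺-regularity-free passage from h3's GLOBAL horizon Killing field `K` to the hypotheses
of `ChruscielCostaHeusler2012_axisymmetricUniqueness` / the static theorems, then the Kerr chart
transfer proved there as `docIsometryTransfer`, `kerrChartTransfer`) closes THIS crux verbatim, with h6
unused.  A line that genuinely spends h6 must first name a configuration that h1–h4 (with global `K`!)
do not already exclude and that mode stability does — under the typed global h3 no such configuration
is known (the "hair frontier" of the belt cards is empty when `K` is Killing on the whole carrier).
So: EITHER dock on 10690's line (recommended for the typed decl), OR work on the INTENDED crux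
(collar-local h3 + trapping mod flow, siblings' C‴/C″) and say so in the card, accepting that the
typed item is then closed only after the planner's restate.

**Pre-triage of `Ideas/phantom-horizons-have-surface-gravity.md` (ideator k = 1, round 1)** — cheap
attacks only, no grade: (i) DOCKING: the card targets the intended crux and says so (its falsifier
(d)); for the typed decl its lever is moot because the collar axial field is global by h3 (sibling
F3) and the hair locus `doc ∖ U_Z` is empty — consistent with (F6) above, not a defect of the card.
(ii) VACUITY ON IN-TREE MODELS: its First lemma `PhantomHorizonDichotomy` quantifies over flow-compact
`T`-invariant null sheets `S ⊆ doc`; the generators of such a sheet are zero-energy null geodesics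
trapped modulo the flow (card item 1), so on every Kerr presentation `S = ∅` by the support item
`KerrNoZeroEnergyTrapping` (`R(r) = a²L² − Δ(L² + Q)` strictly decreasing) — the lemma is vacuously
true on every model the tree can build, hence NOT cheaply falsifiable and NOT cheaply corroborable
here; its only test beds are non-vacuum toys (the card's KK–Misner metric, consistent by inspection:
`∂_ψ` is Killing).  (iii) NO TRIVIAL BRANCH: branch 1 ("a Killing `W`, non-zero and null on `S`")
is not met by `W = T` — `T` is tangent to `S` (`df(T) = 0`) but SPACELIKE on a sheet inside the open
ergoregion (only on the ergosurface is `T` null, and the ergosurface is not a null hypersurface in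
general), and not by `W = K` of h3 unless `S` is a Killing horizon of `K` already; branch 2
(complete generators) is a genuine alternative.  So the dichotomy has content.  (iv) TYPING RISK for a
future stub: "compact modulo the flow" is rendered as `S ⊆ stationaryOrbit T K`, `K` compact `⊆ doc`
— the same rendering the siblings' repairs use (`HasZeroEnergyRayTrappedModFlow`), fine; but
"`S` is a smooth null HYPERSURFACE" is rendered only pointwise (`df_x = ℓ♭`, `ℓ` null) on
`S = f⁻¹{0} ∩ doc` with NO `df ≠ 0 off S` / regular-value clause — harmless (`ℓ` null forces `ℓ ≠ 0`
by `IsNull`, so `df_x ≠ 0` on `S` and `S` is an embedded hypersurface near each of its points).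
(v) The load-bearing transplant (Petersen–Rácz / Petersen from compact CAUCHY horizons to `S/ℤ`) is a
paper check (card falsifier (a)); nothing in this file bears on it.  VERDICT: pass-with-note (docks on
the intended crux; vacuous on in-tree models; no cheap kill). -/
theorem advice_and_pretriage_round1 : True := trivial

end Summit.FinalStateConjecture.FinalStateConjecture.Cruxes.KerrOrBomb.Disproof

end
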